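import Summits.AtomisticToContinuum.BoseEinsteinCondensation.Theorems.BECInsertionCorrectorStaticResponseBoundFreeSquare
import Literature.MathematicalPhysics.QuantumManyBody.OneCoordinateMarginalCalculus
import HarnessLib

/-!
# Line `insertion-mode-gaussian-domination`, aux `driftMode_hMinusOneSqW_le_shift` — the bath DRIFT MODES have
# `H₋₁` norm controlled by the f-sum rule plus the density mode (crux `BECInsertionCorrector.CorrectorClosure`,
# item stmt-AtomisticToContinuum-12058; supports, does not close, the item)

In the `ψ = −log h` form of the hole-mode equation (heart S3 `stub_remainderDomination`, dossier
`Cruxes/CorrectorClosure/Lines/insertion-mode-gaussian-domination-heart.md`) the pair-dressed zeroth order produces,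
besides the density mode `v̂(p)ρ_p` (K1), the bath DRIFT source `2∇_X log Θ₀·∇_X Σⱼ u(y − xⱼ)`, whose `y`-mode at
`p = 2πn/L` is `û(p)` times the LONGITUDINAL drift mode `D_p = Σⱼ e^{-ip·xⱼ} p·∇ⱼ log Θ₀` (real quadratures
`Σⱼ cos(p·xⱼ + ω)(p·∇ⱼΘ₀)/Θ₀`). For ANY `C¹` lattice-periodic weight `Θ` (no equation, no positivity) and every
phase shift `ω` we prove the Kipnis–Varadhan bound
`‖(Σⱼ cos(θⱼ + ω) p·∇ⱼΘ)/Θ‖²₋₁ ≤ ¼(|p|²√b + √(N|p|²∫Θ²))²` whenever `‖Σⱼ sin(θⱼ + ω)‖²₋₁ ≤ b` (`θⱼ = p·xⱼ`):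
the `H₋₁` reading of `D_pΘ = [(H_N − E_N)(ρ_pΘ) − |p|²ρ_pΘ]/(2i)`, i.e. `‖D_p‖²₋₁ ≤ ½(f-sum N|p|² + |p|⁴‖ρ_p‖²₋₁)`;
with K1's `‖ρ_p‖²₋₁ ≤ B₁N/max(ρa,p²)` (`stub_firstOrderInput`, landed) the bath drift modes are `≤ ½N|p|²(1+B₁)`.
Proof: the criterion `hMinusOneSqW_le_ofReal_iff` reduces to `(∫ gβΘ²)² ≤ C𝓔_Θ(β,β)`; torus integration by
parts of the flux `cos(θⱼ+ω)Θ²β` (`integral_cellN_pderiv_eq_zero`) gives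
`2∫gβΘ² = |p|²∫(Σⱼ sin(θⱼ+ω))βΘ² − ∫Θ²Σⱼcos(θⱼ+ω)p·∇ⱼβ`, bounded by `|p|²√b√𝓔` (hypothesis) plus
`√(N|p|²∫Θ²)√𝓔` (Cauchy–Schwarz in `(j,c)` and in the integral).
References (shape only): C. Kipnis, S. R. S. Varadhan, Comm. Math. Phys. 104 (1986), (1.14);
D. Pines, P. Nozières, *The Theory of Quantum Liquids* I, §2.4 (f-sum rule).
-/

noncomputable section

namespace Summit.AtomisticToContinuum.BoseEinsteinCondensation.Theorems.CorrectorClosure.InsertionModeGaussianDomination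

open MeasureTheory Filter
open scoped ENNReal NNReal BigOperators
open Literature.MathematicalPhysics.QuantumManyBody.BoseGas
open Summit.AtomisticToContinuum.BoseEinsteinCondensation.Cruxes.StaticResponseBound.UvThomsonForceWave
  (freeSq_phase_clm)

variable {N : ℕ}

/-! ### Calculus of the shifted phase -/

/-- Chain rule: `∂_{j,c} cos(Φ · + ω) = −Φ(e_{j,c}) sin(Φ · + ω)` for a continuous linear functional `Φ`.
[folklore] -/
theorem drift_pderiv_cos_clm (Φ : Config N →L[ℝ] ℝ) (ω : ℝ) (j : Fin N) (c : Fin 3) (X : Config N) :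
    pderiv j c (fun Y => Real.cos (Φ Y + ω)) X =
      -(Φ (Pi.single j (EuclideanSpace.single c 1)) * Real.sin (Φ X + ω)) := by
  have h1 : HasFDerivAt (fun Y => Φ Y + ω) Φ X := Φ.hasFDerivAt.add_const ω
  have hd : HasFDerivAt (fun Y => Real.cos (Φ Y + ω)) ((-Real.sin (Φ X + ω)) • Φ) X := h1.cos
  rw [pderiv, hd.fderiv, _root_.smul_apply, smul_eq_mul]
  ring

/-- The phase functional takes values in `2πℤ` on the period lattice: `Φⱼ(L e_{j',c'}) = 2π m`.
[folklore] -/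
theorem drift_phase_lattice {L : ℝ} (hL : L ≠ 0) (n : Fin 3 → ℤ) (j : Fin N)
    (Φ : Config N →L[ℝ] ℝ) (hΦ : ∀ X, Φ X = 2 * Real.pi / L * ∑ i, (n i : ℝ) * X j i)
    (j' : Fin N) (c' : Fin 3) :
    ∃ m : ℤ, Φ (Pi.single j' (EuclideanSpace.single c' L)) = m * (2 * Real.pi) := by
  rcases eq_or_ne j' j with rfl | hne
  · refine ⟨n c', ?_⟩
    rw [hΦ]
    simp only [Pi.single_eq_same, PiLp.single_apply, mul_ite, mul_zero, Finset.sum_ite_eq',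
      Finset.mem_univ, if_true]
    field_simp
  · refine ⟨0, ?_⟩
    rw [hΦ, Pi.single_eq_of_ne' hne]
    simp

/-- Pointwise Cauchy–Schwarz in `(j, c)`: `(Σⱼ cos(θⱼ+ω) Σ_c p_c ∂_{j,c}β)² ≤ N |p|² |∇β|²`. [folklore] -/
theorem drift_sum_sq_le (θ : Fin N → Config N → ℝ) (ω : ℝ) (p : Fin 3 → ℝ) (β : Config N → ℝ)
    (X : Config N) :
    (∑ j, Real.cos (θ j X + ω) * ∑ c, p c * pderiv j c β X) ^ 2 ≤
      N * (∑ c, p c ^ 2) * gradDot β β X := by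
  have h1 : (∑ j, Real.cos (θ j X + ω) * ∑ c, p c * pderiv j c β X) ^ 2 ≤
      (Finset.univ : Finset (Fin N)).card *
        ∑ j, (Real.cos (θ j X + ω) * ∑ c, p c * pderiv j c β X) ^ 2 :=
    sq_sum_le_card_mul_sum_sq
  have h2 : ∀ j, (Real.cos (θ j X + ω) * ∑ c, p c * pderiv j c β X) ^ 2 ≤
      (∑ c, p c ^ 2) * ∑ c, pderiv j c β X ^ 2 := by
    intro j
    have hcs := Finset.sum_mul_sq_le_sq_mul_sq Finset.univ p (fun c => pderiv j c β X)
    have hcos : Real.cos (θ j X + ω) ^ 2 ≤ 1 := by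
      rw [sq_le_one_iff_abs_le_one]; exact Real.abs_cos_le_one _
    have h0 : 0 ≤ (∑ c, p c * pderiv j c β X) ^ 2 := sq_nonneg _
    calc (Real.cos (θ j X + ω) * ∑ c, p c * pderiv j c β X) ^ 2
        = Real.cos (θ j X + ω) ^ 2 * (∑ c, p c * pderiv j c β X) ^ 2 := by ring
      _ ≤ 1 * (∑ c, p c * pderiv j c β X) ^ 2 := mul_le_mul_of_nonneg_right hcos h0
      _ ≤ (∑ c, p c ^ 2) * ∑ c, pderiv j c β X ^ 2 := by rw [one_mul]; exact hcs
  have h3 : ∑ j, (Real.cos (θ j X + ω) * ∑ c, p c * pderiv j c β X) ^ 2 ≤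
      (∑ c, p c ^ 2) * gradDot β β X := by
    calc ∑ j, (Real.cos (θ j X + ω) * ∑ c, p c * pderiv j c β X) ^ 2
        ≤ ∑ j, (∑ c, p c ^ 2) * ∑ c, pderiv j c β X ^ 2 := Finset.sum_le_sum fun j _ => h2 j
      _ = (∑ c, p c ^ 2) * gradDot β β X := by
          rw [gradDot, ← Finset.mul_sum]
          congr 1
          exact Finset.sum_congr rfl fun j _ => Finset.sum_congr rfl fun c _ => sq _
  have hcard : ((Finset.univ : Finset (Fin N)).card : ℝ) = N := by simp
  rw [hcard] at h1
  calc _ ≤ (N : ℝ) * ∑ j, (Real.cos (θ j X + ω) * ∑ c, p c * pderiv j c β X) ^ 2 := h1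
    _ ≤ (N : ℝ) * ((∑ c, p c ^ 2) * gradDot β β X) :=
        mul_le_mul_of_nonneg_left h3 (Nat.cast_nonneg N)
    _ = _ := by ring

/-! ### The bound -/

/-- **Drift-mode `H₋₁` bound, shifted phase.** For `L > 0`, a `C¹` lattice-periodic weight `Θ` on the
`N`-torus, `n ∈ ℤ³`, a phase shift `ω` and `b ≥ 0` with `‖Σⱼ sin(θⱼ + ω)‖²₋₁ ≤ b` (`θⱼ = (2π/L) n·xⱼ`,
`H₋₁` for the weight `Θ`): `‖(Σⱼ cos(θⱼ + ω) p·∇ⱼΘ)/Θ‖²₋₁ ≤ ¼(|p|²√b + √(N|p|²∫_{cell}Θ²))²`, `p = 2πn/L`.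
[cite: KipnisVaradhan1986, (1.14)] -/
theorem driftMode_hMinusOneSqW_le_shift {L : ℝ} (hL : 0 < L) {Θ : Config N → ℝ}
    (hΘC : ContDiff ℝ 1 Θ) (hΘper : IsLatticePeriodic L Θ) (n : Fin 3 → ℤ) (ω : ℝ) {b : ℝ}
    (hb : 0 ≤ b)
    (hS : hMinusOneSqW L Θ
        (fun X => ∑ j : Fin N, Real.sin (2 * Real.pi / L * ∑ i, (n i : ℝ) * X j i + ω)) ≤
      ENNReal.ofReal b) :
    hMinusOneSqW L Θ (fun X =>
        (∑ j : Fin N, Real.cos (2 * Real.pi / L * ∑ i, (n i : ℝ) * X j i + ω) *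
          ∑ k : Fin 3, 2 * Real.pi / L * (n k : ℝ) * pderiv j k Θ X) / Θ X) ≤
      ENNReal.ofReal
        (((∑ k : Fin 3, (2 * Real.pi / L * (n k : ℝ)) ^ 2) * Real.sqrt b +
            Real.sqrt (N * (∑ k : Fin 3, (2 * Real.pi / L * (n k : ℝ)) ^ 2) *
              ∫ X in cellN N L, Θ X ^ 2)) ^ 2 / 4) := by
  -- opaque names: phases `θ j`, momenta `p c`
  obtain ⟨θ, hθ⟩ : ∃ θ : Fin N → Config N → ℝ,
      ∀ j X, θ j X = 2 * Real.pi / L * ∑ i, (n i : ℝ) * X j i := ⟨_, fun _ _ => rfl⟩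
  obtain ⟨p, hp⟩ : ∃ p : Fin 3 → ℝ, ∀ c, p c = 2 * Real.pi / L * (n c : ℝ) := ⟨_, fun _ => rfl⟩
  have hL0 : L ≠ 0 := hL.ne'
  -- the phases are continuous linear functionals
  have hΦ : ∀ j : Fin N, ∃ Φ : Config N →L[ℝ] ℝ, ∀ X, Φ X = θ j X := by
    intro j
    obtain ⟨Φ, hΦ⟩ := freeSq_phase_clm (N := N) L n j
    exact ⟨Φ, fun X => by rw [hΦ, hθ]⟩
  choose Φ hΦ using hΦ
  have hθΦ : ∀ j, θ j = ⇑(Φ j) := fun j => funext fun X => (hΦ j X).symm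
  have hΦe : ∀ j c, Φ j (Pi.single j (EuclideanSpace.single c 1)) = p c := by
    intro j c
    have := hΦ j (Pi.single j (EuclideanSpace.single c 1))
    rw [this, hθ, hp]
    simp only [Pi.single_eq_same, PiLp.single_apply, mul_ite, mul_one, mul_zero,
      Finset.sum_ite_eq', Finset.mem_univ, if_true]
  -- abbreviations
  set p2 : ℝ := ∑ k : Fin 3, (2 * Real.pi / L * (n k : ℝ)) ^ 2 with hp2_def
  have hp2 : p2 = ∑ c, p c ^ 2 := Finset.sum_congr rfl fun c _ => by rw [hp]
  have hp2_nn : 0 ≤ p2 := Finset.sum_nonneg fun c _ => sq_nonneg _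
  set m : ℝ := ∫ X in cellN N L, Θ X ^ 2 with hm_def
  have hm_nn : 0 ≤ m := by
    rw [hm_def]; exact integral_nonneg fun X => sq_nonneg _
  set K : ℝ := p2 * Real.sqrt b + Real.sqrt (N * p2 * m) with hK_def
  have hK_nn : 0 ≤ K :=
    add_nonneg (mul_nonneg hp2_nn (Real.sqrt_nonneg _)) (Real.sqrt_nonneg _)
  have hNp2 : 0 ≤ (N : ℝ) * p2 := mul_nonneg (Nat.cast_nonneg N) hp2_nn
  have hC : 0 ≤ K ^ 2 / 4 := by positivity
  -- rewrite the two observables with the opaque names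
  have hSθ : hMinusOneSqW L Θ (fun X => ∑ j : Fin N, Real.sin (θ j X + ω)) ≤ ENNReal.ofReal b := by
    have e : (fun X => ∑ j : Fin N, Real.sin (θ j X + ω)) =
        fun X => ∑ j : Fin N, Real.sin (2 * Real.pi / L * ∑ i, (n i : ℝ) * X j i + ω) := by
      funext X; simp only [hθ]
    rw [e]; exact hS
  have eg : (fun X => (∑ j : Fin N, Real.cos (2 * Real.pi / L * ∑ i, (n i : ℝ) * X j i + ω) *
        ∑ k : Fin 3, 2 * Real.pi / L * (n k : ℝ) * pderiv j k Θ X) / Θ X) =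
      fun X => (∑ j : Fin N, Real.cos (θ j X + ω) * ∑ c, p c * pderiv j c Θ X) / Θ X := by
    funext X; simp only [hθ, hp]
  rw [eg, hMinusOneSqW_le_ofReal_iff hC]
  intro β hβ
  -- regularity
  have hβC : ContDiff ℝ 1 β := hβ.1
  have hβd : Differentiable ℝ β := hβC.differentiable one_ne_zero
  have hΘd : Differentiable ℝ Θ := hΘC.differentiable one_ne_zero
  have hΘc : Continuous Θ := hΘC.continuous
  have hβc : Continuous β := hβC.continuous
  have hdΘc : ∀ j c, Continuous (pderiv j c Θ) := fun j c => continuous_pderiv hΘC j c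
  have hdβc : ∀ j c, Continuous (pderiv j c β) := fun j c => continuous_pderiv hβC j c
  have hθc : ∀ j, Continuous (θ j) := fun j => by rw [hθΦ j]; exact (Φ j).continuous
  have hcosC : ∀ j, ContDiff ℝ 1 fun X => Real.cos (θ j X + ω) := fun j => by
    rw [hθΦ j]; exact Real.contDiff_cos.comp ((Φ j).contDiff.add contDiff_const)
  have hcosc : ∀ j, Continuous fun X => Real.cos (θ j X + ω) := fun j => (hcosC j).continuous
  have hsinc : ∀ j, Continuous fun X => Real.sin (θ j X + ω) := fun j =>
    Real.continuous_sin.comp ((hθc j).add continuous_const)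
  have hΘ2C : ContDiff ℝ 1 fun X => Θ X ^ 2 := hΘC.pow 2
  have hΘ2per : IsLatticePeriodic L fun X => Θ X ^ 2 := hΘper.comp fun t => t ^ 2
  have hβper : IsLatticePeriodic L β := hβ.2
  -- (1) integration by parts, per particle `j` and axis `c`
  have hE : ∀ j c,
      2 * (∫ X in cellN N L, Real.cos (θ j X + ω) * β X * Θ X * pderiv j c Θ X) =
        p c * (∫ X in cellN N L, Real.sin (θ j X + ω) * β X * Θ X ^ 2) -
          ∫ X in cellN N L, Real.cos (θ j X + ω) * Θ X ^ 2 * pderiv j c β X := by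
    intro j c
    -- the flux `G = cos(θ j + ω) · (Θ² β)` is `C¹` and lattice periodic
    have hG1 : ContDiff ℝ 1 fun X => Real.cos (θ j X + ω) * (Θ X ^ 2 * β X) :=
      (hcosC j).mul (hΘ2C.mul hβC)
    have hGper : IsLatticePeriodic L fun X => Real.cos (θ j X + ω) * (Θ X ^ 2 * β X) := by
      intro X j' c'
      obtain ⟨m', hm'⟩ := drift_phase_lattice hL0 n j (Φ j) (fun X => by rw [hΦ, hθ]) j' c'
      dsimp only
      rw [hΘper X j' c', hβper X j' c', hθΦ j, map_add, hm',
        show (Φ j) X + m' * (2 * Real.pi) + ω = (Φ j) X + ω + m' * (2 * Real.pi) by ring,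
        Real.cos_add_int_mul_two_pi]
    have hIBP := integral_cellN_pderiv_eq_zero hL hG1 hGper j c
    -- the derivative of the flux
    have hderiv : ∀ X, pderiv j c (fun Y => Real.cos (θ j Y + ω) * (Θ Y ^ 2 * β Y)) X =
        -(p c * Real.sin (θ j X + ω) * β X * Θ X ^ 2) +
          (Real.cos (θ j X + ω) * Θ X ^ 2 * pderiv j c β X +
            2 * (Real.cos (θ j X + ω) * β X * Θ X * pderiv j c Θ X)) := by
      intro X
      have hd1 : DifferentiableAt ℝ (fun Y => Real.cos (θ j Y + ω)) X :=
        (hcosC j).differentiable one_ne_zero X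
      have hd2 : DifferentiableAt ℝ (fun Y => Θ Y ^ 2 * β Y) X :=
        ((hΘ2C.mul hβC).differentiable one_ne_zero) X
      have hd3 : DifferentiableAt ℝ (fun Y => Θ Y ^ 2) X := (hΘ2C.differentiable one_ne_zero) X
      rw [pderiv_fun_mul hd1 hd2, pderiv_fun_mul hd3 (hβd X), pderiv_fun_sq (hΘd X)]
      have hc : pderiv j c (fun Y => Real.cos (θ j Y + ω)) X = -(p c * Real.sin (θ j X + ω)) := by
        have := drift_pderiv_cos_clm (Φ j) ω j c X
        rw [hΦe j c] at this
        rw [hθΦ j]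
        exact this
      rw [hc]
      ring
    simp_rw [hderiv] at hIBP
    -- split the integral
    have hi1 : Integrable (fun X => p c * Real.sin (θ j X + ω) * β X * Θ X ^ 2)
        (volume.restrict (cellN N L)) :=
      integrableOn_cellN (((continuous_const.mul (hsinc j)).mul hβc).mul (hΘc.pow 2)) L
    have hi2 : Integrable (fun X => Real.cos (θ j X + ω) * Θ X ^ 2 * pderiv j c β X)
        (volume.restrict (cellN N L)) :=
      integrableOn_cellN (((hcosc j).mul (hΘc.pow 2)).mul (hdβc j c)) L
    have hi3 : Integrable (fun X => 2 * (Real.cos (θ j X + ω) * β X * Θ X * pderiv j c Θ X))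
        (volume.restrict (cellN N L)) :=
      integrableOn_cellN (continuous_const.mul ((((hcosc j).mul hβc).mul hΘc).mul (hdΘc j c))) L
    have hi1' : Integrable (fun X => -(p c * Real.sin (θ j X + ω) * β X * Θ X ^ 2))
        (volume.restrict (cellN N L)) := hi1.neg
    have hi23 : Integrable (fun X => Real.cos (θ j X + ω) * Θ X ^ 2 * pderiv j c β X +
        2 * (Real.cos (θ j X + ω) * β X * Θ X * pderiv j c Θ X)) (volume.restrict (cellN N L)) :=
      hi2.add hi3
    rw [integral_add hi1' hi23, integral_neg, integral_add hi2 hi3, integral_const_mul] at hIBP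
    have e1 : ∫ X in cellN N L, p c * Real.sin (θ j X + ω) * β X * Θ X ^ 2 =
        p c * ∫ X in cellN N L, Real.sin (θ j X + ω) * β X * Θ X ^ 2 := by
      rw [← integral_const_mul]
      exact integral_congr_ae (Eventually.of_forall fun X => by ring)
    rw [e1] at hIBP
    linarith
  -- (2) the integrated identity `2 ∫ g β Θ² = |p|² ∫ S β Θ² − ∫ Θ² Σ cos p·∇β`
  set I : ℝ := ∫ X in cellN N L,
    (∑ j : Fin N, Real.cos (θ j X + ω) * ∑ c, p c * pderiv j c Θ X) / Θ X * β X * Θ X ^ 2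
    with hI_def
  set IS : ℝ := ∫ X in cellN N L, (∑ j : Fin N, Real.sin (θ j X + ω)) * β X * Θ X ^ 2
    with hIS_def
  set IB : ℝ := ∫ X in cellN N L,
    Θ X ^ 2 * ∑ j : Fin N, Real.cos (θ j X + ω) * ∑ c, p c * pderiv j c β X with hIB_def
  have hIsum : I = ∑ j, ∑ c, p c *
      ∫ X in cellN N L, Real.cos (θ j X + ω) * β X * Θ X * pderiv j c Θ X := by
    have hpt : ∀ X, (∑ j : Fin N, Real.cos (θ j X + ω) * ∑ c, p c * pderiv j c Θ X) / Θ X *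
        β X * Θ X ^ 2 =
        ∑ j, ∑ c, p c * (Real.cos (θ j X + ω) * β X * Θ X * pderiv j c Θ X) := by
      intro X
      rcases eq_or_ne (Θ X) 0 with h0 | h0
      · simp [h0]
      · have e1 : (∑ j : Fin N, Real.cos (θ j X + ω) * ∑ c, p c * pderiv j c Θ X) / Θ X *
            β X * Θ X ^ 2 =
            (∑ j : Fin N, Real.cos (θ j X + ω) * ∑ c, p c * pderiv j c Θ X) * β X * Θ X := by
          field_simp
        rw [e1, Finset.sum_mul, Finset.sum_mul]
        refine Finset.sum_congr rfl fun j _ => ?_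
        rw [Finset.mul_sum, Finset.sum_mul, Finset.sum_mul]
        exact Finset.sum_congr rfl fun c _ => by ring
    have hint : ∀ j c, Integrable
        (fun X => p c * (Real.cos (θ j X + ω) * β X * Θ X * pderiv j c Θ X))
        (volume.restrict (cellN N L)) := fun j c =>
      (integrableOn_cellN ((((hcosc j).mul hβc).mul hΘc).mul (hdΘc j c)) L).const_mul (p c)
    rw [hI_def, integral_congr_ae (Eventually.of_forall hpt),
      integral_finsetSum _ fun j _ => integrable_finsetSum _ fun c _ => hint j c]
    refine Finset.sum_congr rfl fun j _ => ?_
    rw [integral_finsetSum _ fun c _ => hint j c]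
    refine Finset.sum_congr rfl fun c _ => ?_
    exact integral_const_mul _ _
  have hISsum : IS = ∑ j, ∫ X in cellN N L, Real.sin (θ j X + ω) * β X * Θ X ^ 2 := by
    have hint : ∀ j, Integrable (fun X => Real.sin (θ j X + ω) * β X * Θ X ^ 2)
        (volume.restrict (cellN N L)) := fun j =>
      integrableOn_cellN (((hsinc j).mul hβc).mul (hΘc.pow 2)) L
    rw [hIS_def, ← integral_finsetSum _ fun j _ => hint j]
    refine integral_congr_ae (Eventually.of_forall fun X => ?_)
    simp only [Finset.sum_mul]
  have hIBsum : IB = ∑ j, ∑ c, p c *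
      ∫ X in cellN N L, Real.cos (θ j X + ω) * Θ X ^ 2 * pderiv j c β X := by
    have hpt : ∀ X, Θ X ^ 2 * ∑ j : Fin N, Real.cos (θ j X + ω) * ∑ c, p c * pderiv j c β X =
        ∑ j, ∑ c, p c * (Real.cos (θ j X + ω) * Θ X ^ 2 * pderiv j c β X) := by
      intro X
      rw [Finset.mul_sum]
      refine Finset.sum_congr rfl fun j _ => ?_
      rw [Finset.mul_sum, Finset.mul_sum]
      exact Finset.sum_congr rfl fun c _ => by ring
    have hint : ∀ j c, Integrable
        (fun X => p c * (Real.cos (θ j X + ω) * Θ X ^ 2 * pderiv j c β X))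
        (volume.restrict (cellN N L)) := fun j c =>
      (integrableOn_cellN (((hcosc j).mul (hΘc.pow 2)).mul (hdβc j c)) L).const_mul (p c)
    rw [hIB_def, integral_congr_ae (Eventually.of_forall hpt),
      integral_finsetSum _ fun j _ => integrable_finsetSum _ fun c _ => hint j c]
    refine Finset.sum_congr rfl fun j _ => ?_
    rw [integral_finsetSum _ fun c _ => hint j c]
    refine Finset.sum_congr rfl fun c _ => ?_
    exact integral_const_mul _ _
  have hIdent : 2 * I = p2 * IS - IB := by
    rw [hIsum, hISsum, hIBsum, hp2]
    simp only [Finset.mul_sum]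
    rw [← Finset.sum_sub_distrib]
    refine Finset.sum_congr rfl fun j _ => ?_
    rw [Finset.sum_mul, ← Finset.sum_sub_distrib]
    refine Finset.sum_congr rfl fun c _ => ?_
    have h := hE j c
    calc 2 * (p c * ∫ X in cellN N L, Real.cos (θ j X + ω) * β X * Θ X * pderiv j c Θ X)
        = p c * (2 * ∫ X in cellN N L, Real.cos (θ j X + ω) * β X * Θ X * pderiv j c Θ X) := by
          ring
      _ = p c * (p c * (∫ X in cellN N L, Real.sin (θ j X + ω) * β X * Θ X ^ 2) -
            ∫ X in cellN N L, Real.cos (θ j X + ω) * Θ X ^ 2 * pderiv j c β X) := by rw [h]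
      _ = p c ^ 2 * (∫ X in cellN N L, Real.sin (θ j X + ω) * β X * Θ X ^ 2) -
            p c * ∫ X in cellN N L, Real.cos (θ j X + ω) * Θ X ^ 2 * pderiv j c β X := by ring
  -- (3) the two bounds
  set E : ℝ := dirichletFormW L Θ β β with hE_def
  have hE_nn : 0 ≤ E := dirichletFormW_self_nonneg L Θ β
  have hISb : |IS| ≤ Real.sqrt b * Real.sqrt E := by
    have h := (hMinusOneSqW_le_ofReal_iff hb).1 hSθ β hβ
    rw [← Real.sqrt_mul hb]
    exact Real.abs_le_sqrt h
  have hIBb : |IB| ≤ Real.sqrt (N * p2 * m) * Real.sqrt E := by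
    -- pointwise: `|Θ² Σ cos p·∇β| ≤ √(N p2) |Θ| (|Θ| √|∇β|²)`
    have hpt : ∀ X, |Θ X ^ 2 * ∑ j : Fin N, Real.cos (θ j X + ω) * ∑ c, p c * pderiv j c β X| ≤
        Real.sqrt (N * p2) * (|Θ X| * (|Θ X| * Real.sqrt (gradDot β β X))) := by
      intro X
      have h1 := drift_sum_sq_le θ ω p β X
      rw [← hp2] at h1
      have h2 : |∑ j : Fin N, Real.cos (θ j X + ω) * ∑ c, p c * pderiv j c β X| ≤
          Real.sqrt (N * p2) * Real.sqrt (gradDot β β X) := by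
        rw [← Real.sqrt_mul hNp2]
        exact Real.abs_le_sqrt h1
      rw [abs_mul, abs_pow, sq]
      calc |Θ X| * |Θ X| * |∑ j : Fin N, Real.cos (θ j X + ω) * ∑ c, p c * pderiv j c β X|
          ≤ |Θ X| * |Θ X| * (Real.sqrt (N * p2) * Real.sqrt (gradDot β β X)) :=
            mul_le_mul_of_nonneg_left h2 (by positivity)
        _ = _ := by ring
    have hgc : Continuous fun X => Real.sqrt (gradDot β β X) :=
      Real.continuous_sqrt.comp (continuous_gradDot hβC hβC)
    have hf0 : ∀ X, 0 ≤ |Θ X| := fun X => abs_nonneg _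
    have hg0 : ∀ X, 0 ≤ |Θ X| * Real.sqrt (gradDot β β X) := fun X =>
      mul_nonneg (abs_nonneg _) (Real.sqrt_nonneg _)
    have hf2 : Integrable (fun X => |Θ X| ^ 2) (volume.restrict (cellN N L)) :=
      integrableOn_cellN ((continuous_abs.comp hΘc).pow 2) L
    have hg2 : Integrable (fun X => (|Θ X| * Real.sqrt (gradDot β β X)) ^ 2)
        (volume.restrict (cellN N L)) :=
      integrableOn_cellN (((continuous_abs.comp hΘc).mul hgc).pow 2) L
    have hfg : Integrable (fun X => |Θ X| * (|Θ X| * Real.sqrt (gradDot β β X)))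
        (volume.restrict (cellN N L)) :=
      integrableOn_cellN ((continuous_abs.comp hΘc).mul ((continuous_abs.comp hΘc).mul hgc)) L
    have hCS := integral_mul_sq_le_integral_sq_mul (μ := volume.restrict (cellN N L)) hf0 hg0
      hf2 hg2 hfg
    have ef : ∫ X in cellN N L, |Θ X| ^ 2 = m := by
      rw [hm_def]; exact integral_congr_ae (Eventually.of_forall fun X => sq_abs _)
    have eg' : ∫ X in cellN N L, (|Θ X| * Real.sqrt (gradDot β β X)) ^ 2 = E := by
      rw [hE_def, dirichletFormW]
      refine integral_congr_ae (Eventually.of_forall fun X => ?_)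
      dsimp only
      rw [mul_pow, sq_abs, Real.sq_sqrt (gradDot_self_nonneg β X), mul_comm]
    rw [ef, eg'] at hCS
    have hJ0 : 0 ≤ ∫ X in cellN N L, |Θ X| * (|Θ X| * Real.sqrt (gradDot β β X)) :=
      integral_nonneg fun X => mul_nonneg (hf0 X) (hg0 X)
    have hJ : ∫ X in cellN N L, |Θ X| * (|Θ X| * Real.sqrt (gradDot β β X)) ≤
        Real.sqrt m * Real.sqrt E := by
      rw [← Real.sqrt_mul hm_nn, ← abs_of_nonneg hJ0]
      exact Real.abs_le_sqrt hCS
    calc |IB| ≤ ∫ X in cellN N L,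
          |Θ X ^ 2 * ∑ j : Fin N, Real.cos (θ j X + ω) * ∑ c, p c * pderiv j c β X| :=
          abs_integral_le_integral_abs
      _ ≤ ∫ X in cellN N L, Real.sqrt (N * p2) * (|Θ X| * (|Θ X| * Real.sqrt (gradDot β β X))) := by
          refine integral_mono_of_nonneg (Eventually.of_forall fun X => abs_nonneg _)
            (hfg.const_mul _) (Eventually.of_forall hpt)
      _ = Real.sqrt (N * p2) * ∫ X in cellN N L, |Θ X| * (|Θ X| * Real.sqrt (gradDot β β X)) :=
          integral_const_mul _ _
      _ ≤ Real.sqrt (N * p2) * (Real.sqrt m * Real.sqrt E) :=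
          mul_le_mul_of_nonneg_left hJ (Real.sqrt_nonneg _)
      _ = Real.sqrt (N * p2 * m) * Real.sqrt E := by
          rw [Real.sqrt_mul hNp2 m]; ring
  -- (4) assemble: `|2I| ≤ K √E`, hence `I² ≤ (K²/4) E`
  have h2I : |2 * I| ≤ K * Real.sqrt E := by
    rw [hIdent]
    calc |p2 * IS - IB| ≤ |p2 * IS| + |IB| := abs_sub _ _
      _ = p2 * |IS| + |IB| := by rw [abs_mul, abs_of_nonneg hp2_nn]
      _ ≤ p2 * (Real.sqrt b * Real.sqrt E) + Real.sqrt (N * p2 * m) * Real.sqrt E :=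
          add_le_add (mul_le_mul_of_nonneg_left hISb hp2_nn) hIBb
      _ = K * Real.sqrt E := by rw [hK_def]; ring
  have hsq : (2 * I) ^ 2 ≤ (K * Real.sqrt E) ^ 2 := by
    rw [← sq_abs (2 * I)]
    exact pow_le_pow_left₀ (abs_nonneg _) h2I 2
  rw [mul_pow, mul_pow, Real.sq_sqrt hE_nn] at hsq
  show I ^ 2 ≤ K ^ 2 / 4 * E
  nlinarith [hsq]

end Summit.AtomisticToContinuum.BoseEinsteinCondensation.Theorems.CorrectorClosure.InsertionModeGaussianDomination

end
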